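import Literature.Dynamics.Tilings.BandTiling
import Literature.Dynamics.Tilings.TorusCNF
import HarnessLib

/-!
# Clauses about column states of a band of the torus CNF (toolkit for the band refutation, I)

Topic `Literature/Dynamics/Tilings`. Toolkit for `TorusCNFBandRefutation.lean`, which refutes the
torus CNF `torusCNF T n` (`TorusCNF.lean`) inside bounded-depth Frege whenever the cyclic band of
its first `m + 1` rows admits no tiling, by dynamic programming over COLUMN STATES
`σ : Fin (m+1) → Fin t` (the tiles of the cells `(0, c), …, (m, c)` of a column `c`). This file
fixes the vocabulary:

* `bv hmn c r s` — the variable "cell `(r, c)` carries tile `s`" of `torusCNF` for a band row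
  `r ≤ m < n`; the clauses `NS c σ` ("column `c` is NOT in state `σ`": the negative literals
  `¬x_(r,c,σ r)`), their prefixes `NSP c σ r` (rows `< r`) and the at-least clauses `AL c r k`
  ("cell `(r, c)` carries a tile `≥ k`"), with their values and variables;
* the local consistency predicates `VC T σ` (vertical matching inside a column state) and
  `HC T σ σ'` (horizontal matching of adjacent column states), and the KILLER CLAUSES of
  `torusCNF T n` contained in `NS c σ` (resp. `NS c σ ++ NS c' σ'`) when they fail
  (`exists_killer_of_not_vc`, `exists_killer_of_not_hc`).

Elementary; [folklore].
-/

namespace Literature.Dynamics.Tilings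

namespace TorusBand

open Literature.Computability.Complexity WangTileSet

universe v

variable {C : Type v} [DecidableEq C] {t n m : ℕ}

/-! ### Variables of band cells -/

/-- A band row `r ≤ m` as a row of the `n × n` torus (`m < n`). [folklore] -/
def rowFin (hmn : m < n) (r : Fin (m + 1)) : Fin n :=
  ⟨r.1, lt_of_le_of_lt (Nat.le_of_lt_succ r.2) hmn⟩

/-- The variable "cell `(r, c)` carries tile `s`" (`r` a band row). [folklore] -/
def bv (hmn : m < n) (c : Fin n) (r : Fin (m + 1)) (s : Fin t) : ℕ :=
  torusVar t n (rowFin hmn r) c s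

/-- `bv` is injective in `(c, r, s)`. [folklore] -/
theorem bv_injective {hmn : m < n} {c c' : Fin n} {r r' : Fin (m + 1)} {s s' : Fin t}
    (h : bv hmn c r s = bv hmn c' r' s') : c = c' ∧ r = r' ∧ s = s' := by
  obtain ⟨h1, h2, h3⟩ := torusVar_injective h
  refine ⟨h2, Fin.ext ?_, h3⟩
  have := congrArg Fin.val h1
  simpa [rowFin] using this

/-- Band variables are in range. [folklore] -/
theorem bv_lt (hmn : m < n) (c : Fin n) (r : Fin (m + 1)) (s : Fin t) : bv hmn c r s < n * n * t := by
  unfold bv torusVar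
  have hr : (rowFin hmn r).1 < n := (rowFin hmn r).2
  have h1 : (rowFin hmn r).1 * n + c.1 < n * n := by
    calc (rowFin hmn r).1 * n + c.1 < (rowFin hmn r).1 * n + n := Nat.add_lt_add_left c.2 _
      _ = ((rowFin hmn r).1 + 1) * n := by ring
      _ ≤ n * n := Nat.mul_le_mul_right _ (Nat.succ_le_of_lt hr)
  calc ((rowFin hmn r).1 * n + c.1) * t + s.1 < ((rowFin hmn r).1 * n + c.1) * t + t :=
        Nat.add_lt_add_left s.2 _
    _ = ((rowFin hmn r).1 * n + c.1 + 1) * t := by ring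
    _ ≤ n * n * t := Nat.mul_le_mul_right _ (Nat.succ_le_of_lt h1)

/-! ### The clauses -/

/-- `NS c σ`: "column `c` is not in state `σ`" — the negative literals `¬x_(r,c,σ r)`, `r ≤ m`.
[folklore] -/
def NS (hmn : m < n) (c : Fin n) (σ : Fin (m + 1) → Fin t) : Clause ℕ :=
  (List.finRange (m + 1)).map fun r => (bv hmn c r (σ r), false)

/-- `NSP c σ r`: the prefix of `NS c σ` on the rows `< r`. [folklore] -/
def NSP (hmn : m < n) (c : Fin n) (σ : Fin (m + 1) → Fin t) (r : ℕ) : Clause ℕ :=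
  ((List.finRange (m + 1)).filter fun r' => r'.1 < r).map fun r' => (bv hmn c r' (σ r'), false)

variable (t) in
/-- `AL t c r k`: "cell `(r, c)` carries some tile `≥ k`" — the positive literals `x_(r,c,u)`,
`k ≤ u < t`. [folklore] -/
def AL (hmn : m < n) (c : Fin n) (r : Fin (m + 1)) (k : ℕ) : Clause ℕ :=
  ((List.finRange t).filter fun u => k ≤ u.1).map fun u => (bv hmn c r u, true)

variable {hmn : m < n}

/-- Membership in `NS`. [folklore] -/
theorem mem_NS {c : Fin n} {σ : Fin (m + 1) → Fin t} {l : Literal ℕ} :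
    l ∈ NS hmn c σ ↔ ∃ r, l = (bv hmn c r (σ r), false) := by
  simp only [NS, List.mem_map, List.mem_finRange, true_and]
  exact ⟨fun ⟨r, h⟩ => ⟨r, h.symm⟩, fun ⟨r, h⟩ => ⟨r, h.symm⟩⟩

/-- Membership in `NSP`. [folklore] -/
theorem mem_NSP {c : Fin n} {σ : Fin (m + 1) → Fin t} {r : ℕ} {l : Literal ℕ} :
    l ∈ NSP hmn c σ r ↔ ∃ r' : Fin (m + 1), r'.1 < r ∧ l = (bv hmn c r' (σ r'), false) := by
  simp only [NSP, List.mem_map, List.mem_filter, List.mem_finRange, true_and, decide_eq_true_eq]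
  exact ⟨fun ⟨r', h1, h2⟩ => ⟨r', h1, h2.symm⟩, fun ⟨r', h1, h2⟩ => ⟨r', h1, h2.symm⟩⟩

/-- Membership in `AL`. [folklore] -/
theorem mem_AL {c : Fin n} {r : Fin (m + 1)} {k : ℕ} {l : Literal ℕ} :
    l ∈ AL t hmn c r k ↔ ∃ u : Fin t, k ≤ u.1 ∧ l = (bv hmn c r u, true) := by
  simp only [AL, List.mem_map, List.mem_filter, List.mem_finRange, true_and, decide_eq_true_eq]
  exact ⟨fun ⟨u, h1, h2⟩ => ⟨u, h1, h2.symm⟩, fun ⟨u, h1, h2⟩ => ⟨u, h1, h2.symm⟩⟩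

/-- The full prefix is the whole of `NS`. [folklore] -/
theorem NSP_of_le {c : Fin n} (σ : Fin (m + 1) → Fin t) {r : ℕ} (hr : m + 1 ≤ r) :
    NSP hmn c σ r = NS hmn c σ := by
  unfold NSP NS
  congr 1
  exact List.filter_eq_self.2 fun r' _ => by simpa using lt_of_lt_of_le r'.2 hr

/-- The empty prefix. [folklore] -/
theorem NSP_zero {c : Fin n} (σ : Fin (m + 1) → Fin t) : NSP hmn c σ 0 = [] := by
  unfold NSP
  rw [List.filter_eq_nil_iff.2 fun r' _ => by simp]
  rfl

/-- No tile is `≥ t`: `AL c r t = []`. [folklore] -/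
theorem AL_of_le {c : Fin n} (r : Fin (m + 1)) {k : ℕ} (hk : t ≤ k) : AL t hmn c r k = [] := by
  unfold AL
  rw [List.filter_eq_nil_iff.2 fun u _ => by simpa using lt_of_lt_of_le u.2 hk]
  rfl

/-- Lengths. [folklore] -/
theorem length_NS (c : Fin n) (σ : Fin (m + 1) → Fin t) : (NS hmn c σ).length = m + 1 := by
  simp [NS]

/-- Lengths. [folklore] -/
theorem length_NSP_le (c : Fin n) (σ : Fin (m + 1) → Fin t) (r : ℕ) : (NSP hmn c σ r).length ≤ m + 1 := by
  simp only [NSP, List.length_map]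
  exact (List.length_filter_le _ _).trans (by simp)

/-- Lengths. [folklore] -/
theorem length_AL_le (c : Fin n) (r : Fin (m + 1)) (k : ℕ) : (AL t hmn c r k).length ≤ t := by
  simp only [AL, List.length_map]
  exact (List.length_filter_le _ _).trans (by simp)

/-! ### Values -/

/-- A clause of negative literals is true iff one of its variables is false. [folklore] -/
theorem eval_NS_eq_true_iff (τ : ℕ → Bool) (c : Fin n) (σ : Fin (m + 1) → Fin t) :
    Clause.eval τ (NS hmn c σ) = true ↔ ∃ r, τ (bv hmn c r (σ r)) = false := by
  simp only [Clause.eval, List.any_eq_true, mem_NS]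
  constructor
  · rintro ⟨l, ⟨r, rfl⟩, hl⟩
    refine ⟨r, ?_⟩
    simpa [Literal.eval] using hl
  · rintro ⟨r, hr⟩
    exact ⟨_, ⟨r, rfl⟩, by simpa [Literal.eval] using hr⟩

/-- Value of a prefix clause. [folklore] -/
theorem eval_NSP_eq_true_iff (τ : ℕ → Bool) (c : Fin n) (σ : Fin (m + 1) → Fin t) (r : ℕ) :
    Clause.eval τ (NSP hmn c σ r) = true ↔ ∃ r' : Fin (m + 1), r'.1 < r ∧ τ (bv hmn c r' (σ r')) = false := by
  simp only [Clause.eval, List.any_eq_true, mem_NSP]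
  constructor
  · rintro ⟨l, ⟨r', hr', rfl⟩, hl⟩
    exact ⟨r', hr', by simpa [Literal.eval] using hl⟩
  · rintro ⟨r', hr', h⟩
    exact ⟨_, ⟨r', hr', rfl⟩, by simpa [Literal.eval] using h⟩

/-- Value of an at-least clause. [folklore] -/
theorem eval_AL_eq_true_iff (τ : ℕ → Bool) (c : Fin n) (r : Fin (m + 1)) (k : ℕ) :
    Clause.eval τ (AL t hmn c r k) = true ↔ ∃ u : Fin t, k ≤ u.1 ∧ τ (bv hmn c r u) = true := by
  simp only [Clause.eval, List.any_eq_true, mem_AL]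
  constructor
  · rintro ⟨l, ⟨u, hu, rfl⟩, hl⟩
    exact ⟨u, hu, by simpa [Literal.eval] using hl⟩
  · rintro ⟨u, hu, h⟩
    exact ⟨_, ⟨u, hu, rfl⟩, by simpa [Literal.eval] using h⟩

/-- Value of a concatenation of clauses. [folklore] -/
theorem eval_append (τ : ℕ → Bool) (A B : Clause ℕ) :
    Clause.eval τ (A ++ B) = (Clause.eval τ A || Clause.eval τ B) := by
  simp [Clause.eval, List.any_append]

/-- A clause containing all literals of a true clause is true. [folklore] -/
theorem eval_of_subset {τ : ℕ → Bool} {A B : Clause ℕ} (hsub : ∀ l ∈ A, l ∈ B)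
    (hA : Clause.eval τ A = true) : Clause.eval τ B = true := by
  simp only [Clause.eval, List.any_eq_true] at hA ⊢
  obtain ⟨l, hl, hv⟩ := hA
  exact ⟨l, hsub l hl, hv⟩

/-! ### All column states -/

/-- The list of all column states. [folklore] -/
noncomputable def states (m t : ℕ) : List (Fin (m + 1) → Fin t) :=
  (Finset.univ : Finset (Fin (m + 1) → Fin t)).toList

/-- Every state is listed. [folklore] -/
theorem mem_states (σ : Fin (m + 1) → Fin t) : σ ∈ states m t :=
  Finset.mem_toList.2 (Finset.mem_univ σ)

/-- There are `t^(m+1)` column states. [folklore] -/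
theorem length_states (m t : ℕ) : (states m t).length = t ^ (m + 1) := by
  rw [states, Finset.length_toList, Finset.card_univ, Fintype.card_fun, Fintype.card_fin,
    Fintype.card_fin]

/-! ### Local consistency of column states and the killer clauses -/

/-- Vertical consistency of a column state: consecutive rows match. [folklore] -/
def VC (T : WangTileSet (Fin t) C) (σ : Fin (m + 1) → Fin t) : Prop :=
  ∀ (r : Fin (m + 1)) (h : r.1 + 1 < m + 1), T.south (σ r) = T.north (σ ⟨r.1 + 1, h⟩)

/-- Horizontal consistency of two adjacent column states. [folklore] -/
def HC (T : WangTileSet (Fin t) C) (σ σ' : Fin (m + 1) → Fin t) : Prop :=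
  ∀ r : Fin (m + 1), T.east (σ r) = T.west (σ' r)

/-- **Killer clause of a vertically inconsistent column state**: some vertical mismatch clause of
`torusCNF T n` is contained in `NS c σ`. [folklore] -/
theorem exists_killer_of_not_vc (T : WangTileSet (Fin t) C) (hmn : m < n) (c : Fin n)
    {σ : Fin (m + 1) → Fin t} (h : ¬ VC T σ) :
    ∃ A ∈ T.torusCNF n, ∀ l ∈ A, l ∈ NS hmn c σ := by
  simp only [VC, not_forall] at h
  obtain ⟨r, hr, hne⟩ := h
  set r1 : Fin (m + 1) := ⟨r.1 + 1, hr⟩ with hr1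
  have hrow : (⟨((rowFin hmn r).1 + 1) % n, Nat.mod_lt _ (rowFin hmn r).pos⟩ : Fin n) = rowFin hmn r1 := by
    apply Fin.ext
    simp only [rowFin, hr1]
    exact Nat.mod_eq_of_lt (by omega)
  refine ⟨[(torusVar t n (rowFin hmn r) c (σ r), false),
      (torusVar t n ⟨((rowFin hmn r).1 + 1) % n, Nat.mod_lt _ (rowFin hmn r).pos⟩ c (σ r1), false)],
    (mem_torusCNF_iff T n _).2 (Or.inr (Or.inr (Or.inr ⟨rowFin hmn r, c, σ r, σ r1, hne, rfl⟩))), ?_⟩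
  intro l hl
  simp only [List.mem_cons, List.not_mem_nil, or_false] at hl
  rcases hl with rfl | rfl
  · exact mem_NS.2 ⟨r, rfl⟩
  · rw [hrow]; exact mem_NS.2 ⟨r1, rfl⟩

/-- **Killer clause of a horizontally inconsistent pair of column states** on adjacent columns
`c` and `c' = c + 1 mod n`: some horizontal mismatch clause of `torusCNF T n` is contained in
`NS c σ ++ NS c' σ'`. [folklore] -/
theorem exists_killer_of_not_hc (T : WangTileSet (Fin t) C) (hmn : m < n) {c c' : Fin n}
    (hcc' : c'.1 = (c.1 + 1) % n) {σ σ' : Fin (m + 1) → Fin t} (h : ¬ HC T σ σ') :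
    ∃ A ∈ T.torusCNF n, ∀ l ∈ A, l ∈ NS hmn c σ ++ NS hmn c' σ' := by
  simp only [HC, not_forall] at h
  obtain ⟨r, hne⟩ := h
  have hcol : (⟨(c.1 + 1) % n, Nat.mod_lt _ c.pos⟩ : Fin n) = c' := Fin.ext hcc'.symm
  refine ⟨[(torusVar t n (rowFin hmn r) c (σ r), false),
      (torusVar t n (rowFin hmn r) ⟨(c.1 + 1) % n, Nat.mod_lt _ c.pos⟩ (σ' r), false)],
    (mem_torusCNF_iff T n _).2 (Or.inr (Or.inr (Or.inl ⟨rowFin hmn r, c, σ r, σ' r, hne, rfl⟩))), ?_⟩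
  intro l hl
  simp only [List.mem_cons, List.not_mem_nil, or_false] at hl
  rcases hl with rfl | rfl
  · exact List.mem_append_left _ (mem_NS.2 ⟨r, rfl⟩)
  · rw [hcol]; exact List.mem_append_right _ (mem_NS.2 ⟨r, rfl⟩)

/-- The at-least-one clause of a band cell is a clause of `torusCNF` all of whose literals lie in
`AL t c r 0`, and conversely. [folklore] -/
theorem atLeastOne_mem (T : WangTileSet (Fin t) C) (hmn : m < n) (c : Fin n) (r : Fin (m + 1)) :
    ((List.finRange t).map fun s => (bv hmn c r s, true)) ∈ T.torusCNF n ∧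
      ∀ l, l ∈ ((List.finRange t).map fun s => (bv hmn c r s, true)) ↔ l ∈ AL t hmn c r 0 := by
  refine ⟨(mem_torusCNF_iff T n _).2 (Or.inl ⟨rowFin hmn r, c, rfl⟩), fun l => ?_⟩
  rw [mem_AL, List.mem_map]
  constructor
  · rintro ⟨s, -, rfl⟩
    exact ⟨s, Nat.zero_le _, rfl⟩
  · rintro ⟨s, -, rfl⟩
    exact ⟨s, List.mem_finRange s, rfl⟩

end TorusBand

end Literature.Dynamics.Tilings
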